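import Literature.NumberTheory.EllipticCurves.ComplexMultiplicationDeuringReductionCoxEndProofs
import Literature.NumberTheory.EllipticCurves.ComplexMultiplicationShaRubinRationalCMProofs
import Literature.NumberTheory.EllipticCurves.CMTorsionTwistCharacterProofs
import Literature.NumberTheory.EllipticCurves.EndomorphismRingTwoGeneratedProofs
import Literature.NumberTheory.EllipticCurves.IsogenyGeomEndRingGaloisProofs
import HarnessLib

/-!
# Crux `PrintCf2.SplitBadTwoRankOneOfFacts` (item stmt-BirchSwinnertonDyer-20368), road α over the CM field:
# the complex multiplication `π = [(1 + √−7)/2]` of a curve with `j = −3375`, its Galois conjugates, and its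
# RATIONALITY over every field containing `√−7`

Cell `bsd-print-cf2`, width seat `bsd-line-cf2-p1-w2` g7; `--supports stmt-BirchSwinnertonDyer-20368` (helper). HONEST FRAMING:
nothing here closes a crux or a stub; BSD is not proved by any of this; no summit statement is proved by this seat.

For the crux's class (`W/ℚ` globally minimal, CM, `CMSplit W 2` — CM field `K₀ = ℚ(√−7)`, `2 = 𝔭𝔭̄` split — i.e. the twists
`49a^{(d)}`), the members with `j = −3375` have `End_{ℚ̄}(E) = ℤ[π]`, `π = (1 + √−7)/2`, `π² = π − 2`, `N(π) = 2`, `𝔭 = (π)`. This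
file makes `π` available in the tree's vocabulary (`WeierstrassCurve.geomEndRing`, `endRing`, the `Γ_K`-action on `geomPoints`)
with exactly the properties the CM-prime decomposition `E[2^∞] = E[𝔭^∞] ⊕ E[𝔭̄^∞]` needs (companion file
`PrintCf2SplitBadTwoCMPrimaryDecompositionAtTwo`):

* `exists_cmEndo_of_j_eq_neg3375` — for `W/ℚ` elliptic with `j = −3375`: `π ∈ End_{ℚ̄}(E)` with `π² = π − 2`, `#ker π = 2`,
  `#ker(1 − π) = 2` (Cox §14.B `End ≅ ℤ[ω]`, `deg = N` — the tree's PROVED `Cox2013_exists_ringEquiv_cmRing_geomEndRing_holds` at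
  `α = ω₋₇ + 4`);
* `conj_cmEndo_eq_or` — over any field `K` of characteristic `0`: `σπσ⁻¹ ∈ {π, 1 − π}` for `σ ∈ Γ_K` (`End_{K̄}(E)` is a
  commutative domain stable under `Γ_K`);
* `conj_cmEndo_eq_of_sq_eq_neg_seven`, `cmEndo_mem_endRing_of_sq_eq_neg_seven` — **if `K ∋ θ` with `θ² = −7` and `j = −3375`,
  then `σπσ⁻¹ = π` for EVERY `σ ∈ Γ_K`, i.e. `π ∈ End_K(E)`**: the tree's `K`-rational CM `φ ∉ ℤ`
  (`Rubin1987.hasRationalCM_of_j_eq_neg3375`, Silverman *AT* II.2.2(b)) is commensurable with `ℤ + ℤψ`, `ψ = 2π − 1`, `ψ² = −7`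
  (Cor. III.9.4 in the tree's rational form `exists_intCast_mul_eq_of_mem_geomEndRing`); `σπσ⁻¹ = π̄` would conjugate
  `Nφ = a + bψ` into `Nφ = a − bψ`, forcing `φ ∈ ℤ`;
* `cmEndo_apply_apply` — pointwise `π(πP) = πP − 2P`.
Valid for EVERY `K` of characteristic `0` with `√−7 ∈ K` (number fields `⊇ K₀`, and `2`-adic fields, `√−7 ∈ ℚ₂`).

References: [Cox2013] §14.B, Prop. 14.9; [SilvermanATAEC1994] II §1 Prop. 1.1, II §2 Thm. 2.2(b), App. A §3; [SilvermanAEC2009]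
Cor. III.9.4.
-/

noncomputable section

open scoped Classical ComplexConjugate

set_option linter.dupNamespace false
set_option autoImplicit false

namespace Summit.BirchSwinnertonDyer.BirchSwinnertonDyer.Theorems.PrintCf2.CMPrimes

/-! ## The complex multiplication `π = (1 + √−7)/2` of a curve with `j = −3375`, and its Galois conjugates -/

section Curve

open WeierstrassCurve Literature.NumberTheory.EllipticCurves Field

/-- **`π = [(1 + √−7)/2] ∈ End_{ℚ̄}(E)` for `j(E) = −3375`.** For an elliptic curve `W/ℚ` with `j = −3375 = j(ℤ[(1+√−7)/2])`
there is a geometric endomorphism `π` with `π² = π − 2` whose kernel has order `2 = N(π)`, and `1 − π = π̄` also has a kernel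
of order `2`. (Cox, *Primes of the form x² + ny²*, §14.B: `End_{ℚ̄}(E) ≅ ℤ[ω]`, `deg [α] = N(α)` — the tree's
`Cox2013_exists_ringEquiv_cmRing_geomEndRing_holds`, applied to `α = ω₋₇ + 4 = (1 + √−7)/2`.)
[cite: Cox2013, §14.B and Prop. 14.9 (PDF pp. 318–319)] -/
theorem exists_cmEndo_of_j_eq_neg3375 (W : WeierstrassCurve ℚ) [W.IsElliptic] (hj : W.j = -3375) :
    ∃ π : AddMonoid.End W.geomPoints, π ∈ W.geomEndRing ∧ π * π = π - 2 ∧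
      Nat.card (π : W.geomPoints →+ W.geomPoints).ker = 2 ∧
      Nat.card ((1 - π : AddMonoid.End W.geomPoints) : W.geomPoints →+ W.geomPoints).ker = 2 := by
  have hjmem : W.j ∈ maximalCMJInvariants := by
    rw [hj]; simp [maximalCMJInvariants]
  have hd : cmDiscr W.j = -7 := by rw [hj]; norm_num [cmDiscr]
  obtain ⟨ι₀, hι₀⟩ := Cox2013_exists_ringEquiv_cmRing_geomEndRing_holds W hjmem
  have hd0 : cmDiscr W.j ≤ 0 := by rw [hd]; norm_num
  have hdc : cmDiscr W.j * (cmDiscr W.j - 1) = 4 * 14 := by rw [hd]; norm_num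
  have hsq := cmGen_sq hd0 hdc
  have hdC : ((cmDiscr W.j : ℤ) : ℂ) = -7 := by exact_mod_cast hd
  -- `α = ω + 4 = (1 + √−7)/2` and `1 − α = ω̄ + 4`
  have h4 : (4 : ℂ) ∈ cmRing (cmDiscr W.j) := by exact_mod_cast natCast_mem (cmRing (cmDiscr W.j)) 4
  set α : cmRing (cmDiscr W.j) :=
    ⟨cmGen (cmDiscr W.j) + 4, (cmRing (cmDiscr W.j)).add_mem (cmGen_mem_cmRing _) h4⟩ with hα_def
  have hαC : (α : ℂ) = cmGen (cmDiscr W.j) + 4 := rfl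
  have hαrel : α * α = α - 2 := by
    apply Subtype.ext
    change (cmGen (cmDiscr W.j) + 4) * (cmGen (cmDiscr W.j) + 4) = (cmGen (cmDiscr W.j) + 4) - 2
    linear_combination hsq + cmGen (cmDiscr W.j) * hdC
  have hαconj : (α : ℂ) * conj (α : ℂ) = 2 := by
    rw [hαC, map_add, conj_cmGen, map_ofNat]
    linear_combination -hsq + 4 * hdC
  have hβconj : ((1 - α : cmRing (cmDiscr W.j)) : ℂ) * conj ((1 - α : cmRing (cmDiscr W.j)) : ℂ) = 2 := by
    push_cast
    rw [hαC, map_sub, map_one, map_add, conj_cmGen, map_ofNat]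
    linear_combination -hsq + 3 * hdC
  have him : (cmGen (cmDiscr W.j)).im ≠ 0 := (cmGen_im_pos (by rw [hd]; norm_num)).ne'
  have hα0 : α ≠ 0 := by
    intro h
    have := congrArg (fun z : cmRing (cmDiscr W.j) ↦ (z : ℂ).im) h
    simp [hαC] at this
    exact him this
  have hβ0 : (1 - α : cmRing (cmDiscr W.j)) ≠ 0 := by
    intro h
    have := congrArg (fun z : cmRing (cmDiscr W.j) ↦ (z : ℂ).im) h
    simp [hαC] at this
    exact him (by linarith)
  refine ⟨(ι₀ α : W.geomEndRing), (ι₀ α).2, ?_, ?_, ?_⟩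
  · have h := congrArg (fun z : W.geomEndRing ↦ (z : AddMonoid.End W.geomPoints)) (congrArg ι₀ hαrel)
    have h2 : ((2 : W.geomEndRing) : AddMonoid.End W.geomPoints) = 2 := by
      rw [show (2 : W.geomEndRing) = ((2 : ℕ) : W.geomEndRing) by norm_cast, Subring.coe_natCast]; norm_cast
    simpa [map_mul, map_sub, map_ofNat, h2] using h
  · have h := hι₀ α hα0
    rw [hαconj] at h
    exact_mod_cast h
  · have h := hι₀ (1 - α) hβ0
    rw [hβconj, map_sub, map_one] at h
    exact_mod_cast h

variable {K : Type} [Field K] [CharZero K] (V : WeierstrassCurve K) [V.IsElliptic]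

/-- **Galois conjugates of `π` are `π` or `π̄ = 1 − π`.** For `π ∈ End_{K̄}(E)` with `π² = π − 2` and `σ ∈ Γ_K`,
`σπσ⁻¹ ∈ End_{K̄}(E)` satisfies the same equation, so `(σπσ⁻¹ − π)(σπσ⁻¹ − π̄) = 0` in the commutative domain `End_{K̄}(E)`
(Silverman, *AEC*, III.9.4; the tree's `conj_mem_geomEndRing`, `geomEndRing_comm_holds`, `isDomain_geomEndRing`).
[cite: SilvermanAEC2009, Cor. III.9.4] -/
theorem conj_cmEndo_eq_or {π : AddMonoid.End V.geomPoints} (hπ : π ∈ V.geomEndRing) (hrel : π * π = π - 2)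
    (σ : absoluteGaloisGroup K) :
    DistribMulAction.toAddMonoidEnd (absoluteGaloisGroup K) V.geomPoints σ * π *
        DistribMulAction.toAddMonoidEnd (absoluteGaloisGroup K) V.geomPoints σ⁻¹ = π ∨
      DistribMulAction.toAddMonoidEnd (absoluteGaloisGroup K) V.geomPoints σ * π *
        DistribMulAction.toAddMonoidEnd (absoluteGaloisGroup K) V.geomPoints σ⁻¹ = 1 - π := by
  set g := DistribMulAction.toAddMonoidEnd (absoluteGaloisGroup K) V.geomPoints σ with hg
  set g' := DistribMulAction.toAddMonoidEnd (absoluteGaloisGroup K) V.geomPoints σ⁻¹ with hg'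
  have hgg' : g' * g = 1 := by rw [hg, hg', ← map_mul, inv_mul_cancel, map_one]
  have hgg'2 : g * g' = 1 := by rw [hg, hg', ← map_mul, mul_inv_cancel, map_one]
  have hmem : g * π * g' ∈ V.geomEndRing := conj_mem_geomEndRing V hπ σ
  have hrel' : (g * π * g') * (g * π * g') = g * π * g' - 2 := by
    calc (g * π * g') * (g * π * g') = g * π * (g' * g) * π * g' := by simp only [mul_assoc]
      _ = g * (π * π) * g' := by rw [hgg', mul_one, mul_assoc g π π]
      _ = g * π * g' - 2 := by
        rw [hrel, mul_sub, sub_mul, mul_assoc g π]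
        congr 1
        rw [show (2 : AddMonoid.End V.geomPoints) = ((2 : ℤ) : AddMonoid.End V.geomPoints) by norm_cast,
          (Int.cast_commute 2 g).symm.eq, mul_assoc, hgg'2, mul_one]
  -- in the domain `End_{K̄}(E)`
  haveI := isDomain_geomEndRing V
  letI : CommRing V.geomEndRing :=
    { (inferInstance : Ring V.geomEndRing) with
      mul_comm := fun x y ↦ Subtype.ext (V.geomEndRing_comm_holds _ _ x.2 y.2) }
  set x : V.geomEndRing := ⟨g * π * g', hmem⟩
  set y : V.geomEndRing := ⟨π, hπ⟩
  have hx : x * x = x - 2 := Subtype.ext (by push_cast; exact hrel')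
  have hy : y * y = y - 2 := Subtype.ext (by push_cast; exact hrel)
  have hprod : (x - y) * (x - (1 - y)) = 0 := by linear_combination hx - hy
  rcases mul_eq_zero.mp hprod with h | h
  · exact Or.inl (congrArg Subtype.val (sub_eq_zero.mp h))
  · refine Or.inr ?_
    have := congrArg Subtype.val (sub_eq_zero.mp h)
    simpa using this

/-- **Over `K ∋ √−7` every Galois automorphism commutes with `π`.** Let `V/K` be elliptic with `j(V) = −3375`, `θ ∈ K` with
`θ² = −7`, and `π ∈ End_{K̄}(E)` with `π² = π − 2`. Then `σπσ⁻¹ = π` for every `σ ∈ Γ_K`. Proof: `V` has a `K`-RATIONAL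
endomorphism `φ ∉ ℤ` (the tree's `hasRationalCM_of_j_eq_neg3375`, Silverman *AT* II.2.2(b)); by Cor. III.9.4 in its rational form
(`exists_intCast_mul_eq_of_mem_geomEndRing`) `Nφ = a + bψ` with `ψ = 2π − 1`, `ψ² = −7`, `N ≠ 0`; if `σπσ⁻¹ = π̄` then conjugating
gives `Nφ = a − bψ`, so `b = 0` and `φ = a/N ∈ ℤ` (`exists_eq_intCast_of_intCast_mul_eq_intCast`), a contradiction.
[cite: SilvermanATAEC1994, II §2 Thm. 2.2(b) and App. A §3 (row D = -7)] -/
theorem conj_cmEndo_eq_of_sq_eq_neg_seven (hj : V.j = -3375) {θ : K} (hθ : θ ^ 2 = -7)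
    {π : AddMonoid.End V.geomPoints} (hπ : π ∈ V.geomEndRing) (hrel : π * π = π - 2)
    (σ : absoluteGaloisGroup K) :
    DistribMulAction.toAddMonoidEnd (absoluteGaloisGroup K) V.geomPoints σ * π *
        DistribMulAction.toAddMonoidEnd (absoluteGaloisGroup K) V.geomPoints σ⁻¹ = π := by
  rcases conj_cmEndo_eq_or V hπ hrel σ with h | h
  · exact h
  exfalso
  set G := DistribMulAction.toAddMonoidEnd (absoluteGaloisGroup K) V.geomPoints σ with hG
  set G' := DistribMulAction.toAddMonoidEnd (absoluteGaloisGroup K) V.geomPoints σ⁻¹ with hG'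
  have hG'G : G' * G = 1 := by rw [hG, hG', ← map_mul, inv_mul_cancel, map_one]
  have hGG' : G * G' = 1 := by rw [hG, hG', ← map_mul, mul_inv_cancel, map_one]
  -- the `K`-rational CM endomorphism `φ ∉ ℤ`
  obtain ⟨φ, hφ, hφn⟩ := Rubin1987.hasRationalCM_of_j_eq_neg3375 hj hθ
  have hφg : φ ∈ V.geomEndRing := (Subring.mem_inf.1 hφ).1
  have hφe := (V.mem_equivariantSubring_iff φ).1 (Subring.mem_inf.1 hφ).2
  have hφG : G * φ * G' = φ := by
    have hc : G * φ = φ * G := by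
      ext P
      exact (hφe σ P).symm
    rw [hc, mul_assoc, hGG', mul_one]
  -- the commutative domain `S = End_{K̄}(E)` and conjugation by `σ` as a ring endomorphism of it
  haveI := isDomain_geomEndRing V
  haveI := charZero_geomEndRing V
  letI : CommRing V.geomEndRing :=
    { (inferInstance : Ring V.geomEndRing) with
      mul_comm := fun x y ↦ Subtype.ext (V.geomEndRing_comm_holds _ _ x.2 y.2) }
  let c : V.geomEndRing →+* V.geomEndRing :=
    { toFun := fun x ↦ ⟨G * x * G', conj_mem_geomEndRing V x.2 σ⟩
      map_one' := Subtype.ext (by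
        change G * 1 * G' = 1
        rw [mul_one, hGG'])
      map_mul' := fun x y ↦ Subtype.ext (by
        change G * (x * y) * G' = (G * x * G') * (G * y * G')
        calc G * ((x : AddMonoid.End V.geomPoints) * y) * G'
            = G * x * (G' * G) * y * G' := by rw [hG'G, mul_one]; simp only [mul_assoc]
          _ = (G * x * G') * (G * y * G') := by simp only [mul_assoc])
      map_zero' := Subtype.ext (by
        change G * 0 * G' = 0
        rw [mul_zero, zero_mul])
      map_add' := fun x y ↦ Subtype.ext (by
        change G * (x + y) * G' = G * x * G' + G * y * G'
        rw [mul_add, add_mul]) }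
  set x : V.geomEndRing := ⟨π, hπ⟩ with hx_def
  set y : V.geomEndRing := ⟨φ, hφg⟩ with hy_def
  have hx : x * x = x - 2 := Subtype.ext (by push_cast; exact hrel)
  have hcx : c x = 1 - x := Subtype.ext (by push_cast; exact h)
  have hcy : c y = y := Subtype.ext hφG
  -- `ψ = 2π − 1`, `ψ² = −7`
  set ψ : V.geomEndRing := 2 * x - 1 with hψ_def
  have hψsq : ψ * ψ = ((-7 : ℤ) : V.geomEndRing) := by
    rw [hψ_def]; push_cast; linear_combination (4 : V.geomEndRing) * hx
  have hψsq' : (ψ : AddMonoid.End V.geomPoints) * (ψ : AddMonoid.End V.geomPoints) =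
      ((-7 : ℤ) : AddMonoid.End V.geomPoints) := by
    have := congrArg Subtype.val hψsq
    rwa [Subring.coe_mul, Subring.coe_intCast] at this
  obtain ⟨N, a, b, hN, hNφ⟩ :=
    exists_intCast_mul_eq_of_mem_geomEndRing V ψ.2 (by norm_num : (-7 : ℤ) < 0) hψsq' hφg
  -- the same identity in `S`, and its conjugate
  have hS : (N : V.geomEndRing) * y = a + b * ψ := Subtype.ext (by push_cast; exact hNφ)
  have hS' := congrArg c hS
  simp only [map_mul, map_add, map_intCast, hcy, hψ_def, map_sub, map_ofNat, map_one, hcx] at hS'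
  -- subtract: `2b ψ = 0`, so `b = 0`
  have h2b : ((2 * b : ℤ) : V.geomEndRing) * ψ = 0 := by
    rw [hψ_def]; push_cast; linear_combination hS' - hS
  have hψ0 : ψ ≠ 0 := by
    intro h0
    rw [h0, mul_zero] at hψsq
    exact absurd (geomEndRing_intCast_injective V (hψsq.symm.trans (Int.cast_zero).symm)) (by norm_num)
  have hb : b = 0 := by
    have := (mul_eq_zero.mp h2b).resolve_right hψ0
    have := geomEndRing_intCast_injective V (this.trans (Int.cast_zero).symm)
    omega
  -- hence `Nφ = a`, `φ ∈ ℤ`: contradiction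
  rw [hb, Int.cast_zero, zero_mul, add_zero] at hNφ
  obtain ⟨m, hm⟩ := exists_eq_intCast_of_intCast_mul_eq_intCast V hφg hN hNφ
  exact hφn m hm

/-- **Corollary: over `K ∋ √−7`, `π` is `K`-rational** (`π ∈ End_K(E)`): `π(σP) = σ(πP)` for all `σ ∈ Γ_K`, `P ∈ E(K̄)`.
[cite: SilvermanATAEC1994, II §2 Thm. 2.2(b) and App. A §3 (row D = -7)] -/
theorem cmEndo_mem_endRing_of_sq_eq_neg_seven (hj : V.j = -3375) {θ : K} (hθ : θ ^ 2 = -7)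
    {π : AddMonoid.End V.geomPoints} (hπ : π ∈ V.geomEndRing) (hrel : π * π = π - 2) :
    π ∈ V.endRing ∧ ∀ (σ : absoluteGaloisGroup K) (P : V.geomPoints), π (σ • P) = σ • π P := by
  have key : ∀ (σ : absoluteGaloisGroup K) (P : V.geomPoints), π (σ • P) = σ • π P := by
    intro σ P
    have h := congrArg (fun f : AddMonoid.End V.geomPoints ↦ f (σ • P))
      (conj_cmEndo_eq_of_sq_eq_neg_seven V hj hθ hπ hrel σ)
    simp only [toAddMonoidEnd_mul_mul_toAddMonoidEnd_inv_apply, inv_smul_smul] at h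
    exact h.symm
  exact ⟨Subring.mem_inf.2 ⟨hπ, (V.mem_equivariantSubring_iff π).2 key⟩, key⟩

omit [CharZero K] [V.IsElliptic] in
/-- Pointwise form of `π² = π − 2`: `π(πP) = πP − 2P`. [folklore] -/
theorem cmEndo_apply_apply {π : AddMonoid.End V.geomPoints} (hrel : π * π = π - 2) (P : V.geomPoints) :
    π (π P) = π P - 2 • P := by
  have h := congrArg (fun f : AddMonoid.End V.geomPoints ↦ f P) hrel
  have e : (π - 2 : AddMonoid.End V.geomPoints) P = π P - 2 • P := by
    change (π : V.geomPoints →+ V.geomPoints) P -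
      ((2 : AddMonoid.End V.geomPoints) : V.geomPoints →+ V.geomPoints) P = _
    simp
  simpa [e] using h

end Curve

end Summit.BirchSwinnertonDyer.BirchSwinnertonDyer.Theorems.PrintCf2.CMPrimes

end
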